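import Literature.AlgebraicGeometry.KTheory.EulerCharacteristic
import HarnessLib

/-!
# Grayson's presented relative `K₀` of the pull-back `f^* : Vect(X) → Vect(Y)` and the exactness
# `K₀Ω[f^*] → K₀(X) → K₀(Y)`

D. Grayson (*Relative algebraic K-theory by elementary means*, arXiv:1310.8644) attaches to an exact
functor `F : 𝓜 → 𝓝` between exact categories a pair `Ω[F] = [pB[F] ←Δ− pC[F]]` of exact categories
with weak equivalences (Definitions 1–5) and the abelian group `K₀Ω[F]`, "the quotient of `K₀B[F]`
that equates objects in the image of `Δ[F]` to `0` and equates the source and the target of maps in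
`p`" ("Alternatively, and better for our purposes, is to take that description as the definition of
`K₀Ω[F]`"), and proves BY ELEMENTARY MEANS (Theorem 7, Corollary 9) that
`K₁𝓜 → K₁𝓝 → K₀Ω[F] → K₀𝓜 → K₀𝓝` is exact. Conjecturally (loc. cit., Conjecture 6) `K₀Ω[F]` is the
homotopy-theoretic relative group `K₀(F)`.

This file formalizes the `K₀`-END of this for the pull-back `F = f^*` along a morphism of schemes
`f : Y ⟶ X`, with `𝓜 = Vect(X)`, `𝓝 = Vect(Y)` the exact categories of vector bundles realised inside
the abelian categories of `𝒪`-modules (tree: `KTheory.KZero`, `Motives.IsFiniteLocallyFree`):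

* §1 `BinaryComplex C` — Grayson's binary (co)chain complexes `(N, d, d')` ("`d` is the top
  differential, and `d'` is the bottom differential"), with `top`, `bot`, the diagonal `diag K = (K, d, d)`
  and morphisms ("a single map `M → N` that commutes with both differentials"); the three-term binary
  complexes `threeTermBinary` used in Lemma 19.
* §2 `GraysonTriple f` — the objects `(M, N, u)` of `B[f^*]` (Definition 2): `M = (M₁, M₂)` a pair of
  bounded complexes of vector bundles on `X`, `N` a bounded binary complex of vector bundles on `Y`,
  `u = (u₁ : f^*M₁ → ⊤N, u₂ : f^*M₂ → ⊥N)` quasi-isomorphisms; their morphisms, short exact sequences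
  (componentwise and degreewise), the weak equivalences `p = (q, i)` (Definition 4: quasi-isomorphism on
  `M`, isomorphism on `N`) and the diagonal objects `Δ(M, N, u) = ((M, M), ΔN, (u, u))` coming from
  `C[f^*]` (Definitions 1, 5).
* §3 `RelKZero f` — **`K₀Ω[f^*]`** by Grayson's presentation: the free abelian group on the objects of
  `B[f^*]` modulo `[T] = [T'] + [T'']` for short exact `0 → T' → T → T'' → 0`, `[Δ C] = 0`, and
  `[T] = [T']` for every weak equivalence `T → T'` in `p`.
* §4 `RelKZero.toKZero : K₀Ω[f^*] →+ K₀(X)`, `[(M, N, u)] ↦ χ(M₁) − χ(M₂)` — the map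
  `K₀Ω[F] → K₀Ω[𝓜 → 0] ≅ K₀𝓜` of Theorem 7 (induced by `(1, 0)`, with Lemma 8's identification
  `K₀Ω[𝓜 → 0] ≅ K₀𝓜` by the Euler characteristic, `KTheory/EulerCharacteristic`); well defined because
  `χ` is additive, vanishes on `χ(M) − χ(M)` and is a quasi-isomorphism invariant.
* §5 **`RelKZero.range_toKZero_eq_ker` (Grayson, Theorem 7 / Corollary 9 at `K₀𝓜`)**:
  `im(K₀Ω[f^*] → K₀(X)) = ker(f^* : K₀(X) → K₀(Y))`. `⊆` (Corollary 16 at `K₀𝓜`):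
  `f^*(χ M₁ − χ M₂) = χ(f^*M₁) − χ(f^*M₂) = χ(⊤N) − χ(⊥N) = 0`, the `uᵢ` being quasi-isomorphisms and
  `⊤N`, `⊥N` having the same terms. `⊇` is **Lemma 19** verbatim: "we consider an arbitrary element
  `[M] − [M']` of `K₀𝓜` killed by `F` … By (Corollary 18) applied to `FM` and `FM'` we find exact
  sequences `0 → FM → N⁰ → N¹ → N² → 0` and `0 → FM' → N⁰ → N¹ → N² → 0` in `𝓝`. Let `N` denote the
  binary complex `(N, d, d')` and regard `u` and `u'` as quasi-isomorphisms `u : FM → ⊤N` and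
  `u' : FM' → ⊥N`. … The class in `K₀Ω[F]` of the object `((M, M'), N, (u, u'))` projects to `[M] − [M']`
  in `K₀𝓜`" — with every class of `K₀(X)` a difference `[M] − [M']` and Corollary 18 from
  `KTheory/HellerCriterion`.

Faithfulness notes. (i) Grayson works with exact categories "supporting long exact sequences" and
with quasi-isomorphisms of `C𝓝` defined through acyclicity IN `𝓝`; for `𝓝 = Vect(Y)` inside
`Mod(𝒪_Y)` a bounded complex of vector bundles is acyclic in `Vect(Y)` iff it is acyclic as a complex
of `𝒪_Y`-modules (its cycles are then vector bundles, `IsBoundedVBComplex.isFiniteLocallyFree_kernel`),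
so Mathlib's `QuasiIso` is used. (ii) Cochain (`ℤ`-indexed, `ComplexShape.up`) conventions replace
Grayson's chain complexes. (iii) The short exact sequences of `B[F]` are the componentwise-and-degreewise
short exact ones (the exact structure of categories of (binary) complexes and of triples). (iv) Only
the `K₀𝓜`-spot of Theorem 7 is proved here; `K₁` (Nenashev's presentation, Lemma 8) and exactness at
`K₀Ω[F]` and `K₁𝓝` are not formalized. (v) For `f = i : X_m ↪ X_n` a nilpotent thickening this is the
exact sequence `K₀(X_n, X_m) → K₀(X_n) → K₀(X_m)` entering X. Hu's kernel presentation
(`KTheory/HuInfinitesimalKZero`), for the PRESENTED relative group; its identification with the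
Thomason–Trobaugh relative `K₀` is Grayson's Conjecture 6 and is not asserted.

## References

* D. R. Grayson, *Relative algebraic K-theory by elementary means*, arXiv:1310.8644 (2013),
  Definitions 1–5, Conjecture 6, Theorem 7, Lemma 8, Corollary 9, Corollary 16, Lemma 19.
  [Grayson2013RelativeKTheory]
* M. Schlichting, *Higher algebraic K-theory*, LNM 2008 (2011), §3.1. [Schlichting2011HigherKTheory]
-/

universe u

open CategoryTheory CategoryTheory.Limits AlgebraicGeometry ZeroObject
open Literature.AlgebraicGeometry.Motives

noncomputable section

namespace Literature.AlgebraicGeometry.KTheory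

/-! ## §1. Binary complexes -/

section Binary

variable (C : Type*) [Category C] [HasZeroMorphisms C]

/-- A **binary (cochain) complex** `(N, d, d')`: a `ℤ`-graded object with TWO differentials, the top
one `d` and the bottom one `d'` (Grayson: "the exact category of bounded binary chain complexes
`(N, d, d')` of objects of `𝓝`; here `d` is the top differential, and `d'` is the bottom differential").
Boundedness is imposed separately (`IsBoundedVBComplex` of `top`). [cite: Grayson2013RelativeKTheory, §1] -/
structure BinaryComplex where
  /-- The graded object. -/
  X : ℤ → C
  /-- The top differential. -/
  dTop : ∀ i j : ℤ, X i ⟶ X j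
  /-- The top differential vanishes off the shape `i + 1 = j`. -/
  shape_top : ∀ i j : ℤ, ¬ (ComplexShape.up ℤ).Rel i j → dTop i j = 0
  /-- `d ∘ d = 0` for the top differential. -/
  dTop_comp : ∀ i j k : ℤ, (ComplexShape.up ℤ).Rel i j → (ComplexShape.up ℤ).Rel j k →
    dTop i j ≫ dTop j k = 0
  /-- The bottom differential. -/
  dBot : ∀ i j : ℤ, X i ⟶ X j
  /-- The bottom differential vanishes off the shape `i + 1 = j`. -/
  shape_bot : ∀ i j : ℤ, ¬ (ComplexShape.up ℤ).Rel i j → dBot i j = 0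
  /-- `d' ∘ d' = 0` for the bottom differential. -/
  dBot_comp : ∀ i j k : ℤ, (ComplexShape.up ℤ).Rel i j → (ComplexShape.up ℤ).Rel j k →
    dBot i j ≫ dBot j k = 0

variable {C}

namespace BinaryComplex

/-- The top complex `⊤N = (N, d)`. [cite: Grayson2013RelativeKTheory, §1] -/
def top (N : BinaryComplex C) : CochainComplex C ℤ where
  X := N.X
  d := N.dTop
  shape := N.shape_top
  d_comp_d' := N.dTop_comp

/-- The bottom complex `⊥N = (N, d')`. [cite: Grayson2013RelativeKTheory, §1] -/
def bot (N : BinaryComplex C) : CochainComplex C ℤ where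
  X := N.X
  d := N.dBot
  shape := N.shape_bot
  d_comp_d' := N.dBot_comp

/-- `⊤N` and `⊥N` have the same terms. [cite: Grayson2013RelativeKTheory, §1] -/
@[simp] theorem top_X (N : BinaryComplex C) (i : ℤ) : N.top.X i = N.X i := rfl

/-- `⊤N` and `⊥N` have the same terms. [cite: Grayson2013RelativeKTheory, §1] -/
@[simp] theorem bot_X (N : BinaryComplex C) (i : ℤ) : N.bot.X i = N.X i := rfl

/-- The **diagonal** binary complex `ΔK = (K, d, d)` of a complex ("An object in the image of a functor
`Δ` is called diagonal"). [cite: Grayson2013RelativeKTheory, §1] -/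
def diag (K : CochainComplex C ℤ) : BinaryComplex C :=
  ⟨K.X, K.d, K.shape, K.d_comp_d', K.d, K.shape, K.d_comp_d'⟩

/-- `⊤ΔK = K`. [cite: Grayson2013RelativeKTheory, §1] -/
@[simp] theorem diag_top (K : CochainComplex C ℤ) : (diag K).top = K := rfl

/-- `⊥ΔK = K`. [cite: Grayson2013RelativeKTheory, §1] -/
@[simp] theorem diag_bot (K : CochainComplex C ℤ) : (diag K).bot = K := rfl

/-- A **morphism of binary complexes**: "a map `(M, c, c') → (N, d, d')` in `B𝓝` is a single map
`M → N` … that commutes with both differentials". [cite: Grayson2013RelativeKTheory, §1] -/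
structure Hom (N N' : BinaryComplex C) where
  /-- The components. -/
  f : ∀ i, N.X i ⟶ N'.X i
  /-- Compatibility with the top differentials. -/
  comm_top : ∀ i j, f i ≫ N'.dTop i j = N.dTop i j ≫ f j
  /-- Compatibility with the bottom differentials. -/
  comm_bot : ∀ i j, f i ≫ N'.dBot i j = N.dBot i j ≫ f j

/-- The morphism of top complexes underlying a morphism of binary complexes. [cite: Grayson2013RelativeKTheory, §1] -/
def Hom.top {N N' : BinaryComplex C} (g : Hom N N') : N.top ⟶ N'.top where
  f := g.f
  comm' i j _ := g.comm_top i j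

/-- The morphism of bottom complexes underlying a morphism of binary complexes. [cite: Grayson2013RelativeKTheory, §1] -/
def Hom.bot {N N' : BinaryComplex C} (g : Hom N N') : N.bot ⟶ N'.bot where
  f := g.f
  comm' i j _ := g.comm_bot i j

/-- The identity morphism of a binary complex. [folklore] -/
def Hom.id (N : BinaryComplex C) : Hom N N where
  f i := 𝟙 _
  comm_top i j := by rw [Category.id_comp, Category.comp_id]
  comm_bot i j := by rw [Category.id_comp, Category.comp_id]

/-- A morphism of binary complexes is an **isomorphism of `B𝓝`** iff all its components are
isomorphisms (the inverse then commutes with both differentials). [folklore] -/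
def Hom.IsIso {N N' : BinaryComplex C} (g : Hom N N') : Prop := ∀ i, CategoryTheory.IsIso (g.f i)

/-! ### Three-term binary complexes -/

variable [HasZeroObject C] {V₀ V₁ V₂ : C}

variable (V₀ V₁ V₂) in
/-- The graded object `(V₀, V₁, V₂, 0, …)` in degrees `0, 1, 2`. [folklore] -/
def threeX : ℤ → C
  | 0 => V₀
  | 1 => V₁
  | 2 => V₂
  | _ => 0

/-- The differential of the three-term complex `V₀ →ᵇ V₁ →ᶜ V₂` in degrees `0, 1, 2`. [folklore] -/
def threeD (b : V₀ ⟶ V₁) (c : V₁ ⟶ V₂) : ∀ i j : ℤ, threeX V₀ V₁ V₂ i ⟶ threeX V₀ V₁ V₂ j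
  | 0, 1 => b
  | 1, 2 => c
  | _, _ => 0

/-- Off `(0,1)` and `(1,2)` the differential is zero. [folklore] -/
theorem threeD_eq_zero (b : V₀ ⟶ V₁) (c : V₁ ⟶ V₂) (i j : ℤ) (h₁ : ¬ (i = 0 ∧ j = 1))
    (h₂ : ¬ (i = 1 ∧ j = 2)) : threeD b c i j = 0 := by
  unfold threeD
  split
  · exact absurd ⟨rfl, rfl⟩ h₁
  · exact absurd ⟨rfl, rfl⟩ h₂
  · rfl

/-- The differential has the cochain shape. [folklore] -/
theorem threeD_shape (b : V₀ ⟶ V₁) (c : V₁ ⟶ V₂) (i j : ℤ) (h : ¬ (ComplexShape.up ℤ).Rel i j) :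
    threeD b c i j = 0 :=
  threeD_eq_zero b c i j (fun hij ↦ h (by obtain ⟨rfl, rfl⟩ := hij; rfl))
    (fun hij ↦ h (by obtain ⟨rfl, rfl⟩ := hij; rfl))

/-- `d ∘ d = 0` for the three-term differential (the only case is `b ≫ c = 0`). [folklore] -/
theorem threeD_comp (b : V₀ ⟶ V₁) (c : V₁ ⟶ V₂) (w : b ≫ c = 0) (i j k : ℤ) :
    threeD b c i j ≫ threeD b c j k = 0 := by
  by_cases hij : i = 0 ∧ j = 1
  · obtain ⟨rfl, rfl⟩ := hij
    by_cases hk : k = 2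
    · subst hk
      exact w
    · rw [threeD_eq_zero b c 1 k (by omega) (by omega), comp_zero]
  · by_cases hjk : i = 1 ∧ j = 2
    · obtain ⟨rfl, rfl⟩ := hjk
      rw [threeD_eq_zero b c 2 k (by omega) (by omega), comp_zero]
    · rw [threeD_eq_zero b c i j hij hjk, zero_comp]

omit [HasZeroMorphisms C] in
/-- Terms off `{0, 1, 2}` are zero. [folklore] -/
theorem isZero_threeX (i : ℤ) (h0 : i ≠ 0) (h1 : i ≠ 1) (h2 : i ≠ 2) :
    IsZero (threeX V₀ V₁ V₂ i) := by
  unfold threeX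
  split
  · exact absurd rfl h0
  · exact absurd rfl h1
  · exact absurd rfl h2
  · exact isZero_zero C

/-- **The three-term binary complex** `(V₀ → V₁ → V₂; (b, c), (b', c'))` in degrees `0, 1, 2` — "the
binary complex `(N, d, d')`" of Grayson's Lemma 19. [cite: Grayson2013RelativeKTheory, Lemma 19 (proof)] -/
def threeTermBinary (b : V₀ ⟶ V₁) (c : V₁ ⟶ V₂) (w : b ≫ c = 0) (b' : V₀ ⟶ V₁) (c' : V₁ ⟶ V₂)
    (w' : b' ≫ c' = 0) : BinaryComplex C where
  X := threeX V₀ V₁ V₂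
  dTop := threeD b c
  shape_top := threeD_shape b c
  dTop_comp i j k _ _ := threeD_comp b c w i j k
  dBot := threeD b' c'
  shape_bot := threeD_shape b' c'
  dBot_comp i j k _ _ := threeD_comp b' c' w' i j k

end BinaryComplex

end Binary

/-! ## §2. Grayson's category `B[f^*]` of triples -/

variable {X Y : Scheme.{u}} (f : Y ⟶ X)

/-- The pull-back `f^*` on cochain complexes of `𝒪`-modules (Grayson's exact functor `F`, here
`F = f^* : Vect(X) → Vect(Y)` extended to complexes). [folklore] -/
abbrev pullbackComplex : CochainComplex X.Modules ℤ ⥤ CochainComplex Y.Modules ℤ :=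
  (Scheme.Modules.pullback f).mapHomologicalComplex (ComplexShape.up ℤ)

/-- **An object `(M, N, u)` of Grayson's `B[F]`** for `F = f^*` (Definition 2): `M = (M₁, M₂) ∈ C𝓜²`
a pair of bounded complexes of vector bundles on `X`, `N ∈ B𝓝` a bounded binary complex of vector
bundles on `Y`, and `u : FM → ⊤⊥N` a quasi-isomorphism of `C𝓝²`, i.e. quasi-isomorphisms
`u₁ : f^*M₁ → ⊤N`, `u₂ : f^*M₂ → ⊥N` ("We call `u` the comparison map").
[cite: Grayson2013RelativeKTheory, Definition 2] -/
structure GraysonTriple where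
  /-- The first complex `M₁` of the pair `M = (M₁, M₂)`. -/
  M₁ : CochainComplex X.Modules ℤ
  /-- The second complex `M₂` of the pair `M = (M₁, M₂)`. -/
  M₂ : CochainComplex X.Modules ℤ
  /-- The binary complex `N`. -/
  N : BinaryComplex Y.Modules
  /-- The comparison map `u₁ : f^*M₁ → ⊤N`. -/
  u₁ : (pullbackComplex f).obj M₁ ⟶ N.top
  /-- The comparison map `u₂ : f^*M₂ → ⊥N`. -/
  u₂ : (pullbackComplex f).obj M₂ ⟶ N.bot
  /-- `M₁` is a bounded complex of vector bundles. -/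
  hM₁ : IsBoundedVBComplex M₁
  /-- `M₂` is a bounded complex of vector bundles. -/
  hM₂ : IsBoundedVBComplex M₂
  /-- `N` is a bounded binary complex of vector bundles. -/
  hN : IsBoundedVBComplex N.top
  /-- `u₁` is a quasi-isomorphism. -/
  quasiIso₁ : QuasiIso u₁
  /-- `u₂` is a quasi-isomorphism. -/
  quasiIso₂ : QuasiIso u₂

namespace GraysonTriple

variable {f}

/-- `⊥N` is a bounded complex of vector bundles as well (same terms as `⊤N`). [folklore] -/
theorem hN_bot (T : GraysonTriple f) : IsBoundedVBComplex T.N.bot :=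
  T.hN.of_iso fun _ ↦ Iso.refl _

/-- **A morphism `(M, N, u) → (M', N', u')` of `B[F]`**: "a pair `(f, g)` consisting of maps `f : M → M'`
in `C𝓜²` and `g : N → N'` in `B𝓝` such that `u' ∘ Ff = ⊤⊥g ∘ u`".
[cite: Grayson2013RelativeKTheory, Definition 2] -/
structure Hom (T T' : GraysonTriple f) where
  /-- The first component `M₁ → M₁'` of `f : M → M'`. -/
  φ₁ : T.M₁ ⟶ T'.M₁
  /-- The second component `M₂ → M₂'` of `f : M → M'`. -/
  φ₂ : T.M₂ ⟶ T'.M₂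
  /-- The morphism of binary complexes `g : N → N'`. -/
  γ : BinaryComplex.Hom T.N T'.N
  /-- `u₁' ∘ f^*φ₁ = ⊤g ∘ u₁`. -/
  comm₁ : (pullbackComplex f).map φ₁ ≫ T'.u₁ = T.u₁ ≫ γ.top
  /-- `u₂' ∘ f^*φ₂ = ⊥g ∘ u₂`. -/
  comm₂ : (pullbackComplex f).map φ₂ ≫ T'.u₂ = T.u₂ ≫ γ.bot

/-- **Short exact sequences `0 → T' → T → T'' → 0` of `B[F]`**: componentwise (on `M₁`, `M₂`, `N`) and
degreewise short exact sequences (the exact structure on categories of (binary) complexes and of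
triples). [cite: Grayson2013RelativeKTheory, Definition 2] -/
def IsShortExact {T' T T'' : GraysonTriple f} (a : Hom T' T) (b : Hom T T'') : Prop :=
  (∀ i, ∃ w : a.φ₁.f i ≫ b.φ₁.f i = 0, (ShortComplex.mk _ _ w).ShortExact) ∧
  (∀ i, ∃ w : a.φ₂.f i ≫ b.φ₂.f i = 0, (ShortComplex.mk _ _ w).ShortExact) ∧
  (∀ i, ∃ w : a.γ.f i ≫ b.γ.f i = 0, (ShortComplex.mk _ _ w).ShortExact)

/-- **The weak equivalences `p = (q, i)`** (Definition 4): "arrows `f : X → X'` where `f_M : X_M → X'_M`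
is a quasi-isomorphism of `C𝓜²` and `f_N : X_N → X'_N` is an isomorphism of `B𝓝`".
[cite: Grayson2013RelativeKTheory, Definition 4] -/
def Hom.IsWeakEquiv {T T' : GraysonTriple f} (h : Hom T T') : Prop :=
  QuasiIso h.φ₁ ∧ QuasiIso h.φ₂ ∧ h.γ.IsIso

variable (f) in
/-- **An object `(M, N, u)` of Grayson's `C[F]`** for `F = f^*` (Definition 1): `M ∈ C𝓜` a bounded
complex of vector bundles on `X`, `N ∈ C𝓝` one on `Y`, and a quasi-isomorphism `u : FM → N`.
[cite: Grayson2013RelativeKTheory, Definition 1] -/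
structure CTriple where
  /-- The complex `M` on `X`. -/
  M : CochainComplex X.Modules ℤ
  /-- The complex `N` on `Y`. -/
  N : CochainComplex Y.Modules ℤ
  /-- The comparison quasi-isomorphism `u : f^*M → N`. -/
  u : (pullbackComplex f).obj M ⟶ N
  /-- `M` is a bounded complex of vector bundles. -/
  hM : IsBoundedVBComplex M
  /-- `N` is a bounded complex of vector bundles. -/
  hN : IsBoundedVBComplex N
  /-- `u` is a quasi-isomorphism. -/
  quasiIso : QuasiIso u

/-- **The diagonal functor `Δ : C[F] → B[F]`**, `(M, N, u) ↦ (ΔM, ΔN, Δu) = ((M, M), (N, d, d), (u, u))`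
(Definition 2, the functor `Δ`; Definition 5, `Δ[F]`). [cite: Grayson2013RelativeKTheory, Definitions 2 and 5] -/
def CTriple.diag (c : CTriple f) : GraysonTriple f where
  M₁ := c.M
  M₂ := c.M
  N := BinaryComplex.diag c.N
  u₁ := c.u
  u₂ := c.u
  hM₁ := c.hM
  hM₂ := c.hM
  hN := c.hN
  quasiIso₁ := c.quasiIso
  quasiIso₂ := c.quasiIso

end GraysonTriple

/-! ## §3. The presented relative group `K₀Ω[f^*]` -/

/-- The defining relations of `K₀Ω[f^*]`: `[T] − [T'] − [T'']` for short exact `0 → T' → T → T'' → 0` in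
`B[F]` (the relations of `K₀B[F]`), `[ΔC]` for `C ∈ C[F]` ("equates objects in the image of `Δ[F]` to
`0`"), and `[T] − [T']` for weak equivalences `T → T'` in `p` ("equates the source and the target of maps
in `p`"). [cite: Grayson2013RelativeKTheory, Definition 5 ff.] -/
def RelKZero.relations : AddSubgroup (FreeAbelianGroup (GraysonTriple f)) :=
  AddSubgroup.closure
    ({x | ∃ (T' T T'' : GraysonTriple f) (a : GraysonTriple.Hom T' T) (b : GraysonTriple.Hom T T''),
        GraysonTriple.IsShortExact a b ∧
        x = FreeAbelianGroup.of T - FreeAbelianGroup.of T' - FreeAbelianGroup.of T''} ∪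
    {x | ∃ c : GraysonTriple.CTriple f, x = FreeAbelianGroup.of c.diag} ∪
    {x | ∃ (T T' : GraysonTriple f) (h : GraysonTriple.Hom T T'), h.IsWeakEquiv ∧
        x = FreeAbelianGroup.of T - FreeAbelianGroup.of T'})

/-- **Grayson's relative group `K₀Ω[f^*]`** for the pull-back `f^* : Vect(X) → Vect(Y)`: "the quotient
of `K₀B[F]` that equates objects in the image of `Δ[F]` to `0` and equates the source and the target of
maps in `p`. Alternatively, and better for our purposes, is to take that description as the definition of
`K₀Ω[F]`." Conjecturally the homotopy-theoretic relative `K₀` of `f^*` (loc. cit., Conjecture 6 — not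
asserted here). [cite: Grayson2013RelativeKTheory, Definition 5 ff.] -/
def RelKZero : Type (u + 1) :=
  FreeAbelianGroup (GraysonTriple f) ⧸ RelKZero.relations f

/-- `K₀Ω[f^*]` is an abelian group. [folklore] -/
instance RelKZero.instAddCommGroup : AddCommGroup (RelKZero f) :=
  inferInstanceAs (AddCommGroup (FreeAbelianGroup (GraysonTriple f) ⧸ RelKZero.relations f))

namespace RelKZero

variable {f}

/-- The class `[T] ∈ K₀Ω[f^*]` of an object of `B[F]`. [cite: Grayson2013RelativeKTheory, Definition 5 ff.] -/
def mk (T : GraysonTriple f) : RelKZero f :=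
  (QuotientAddGroup.mk (FreeAbelianGroup.of T) : FreeAbelianGroup (GraysonTriple f) ⧸ relations f)

/-- The class of an object is the image of its generator under the quotient map. [folklore] -/
theorem mk_eq_mk' (T : GraysonTriple f) :
    mk T = QuotientAddGroup.mk' (relations f) (FreeAbelianGroup.of T) := rfl

/-- **Additivity**: `[T] = [T'] + [T'']` for a short exact `0 → T' → T → T'' → 0` in `B[F]`.
[cite: Grayson2013RelativeKTheory, Definition 5 ff.] -/
theorem mk_eq_add_of_isShortExact {T' T T'' : GraysonTriple f} (a : GraysonTriple.Hom T' T)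
    (b : GraysonTriple.Hom T T'') (h : GraysonTriple.IsShortExact a b) : mk T = mk T' + mk T'' := by
  have hmem : FreeAbelianGroup.of T - FreeAbelianGroup.of T' - FreeAbelianGroup.of T'' ∈ relations f :=
    AddSubgroup.subset_closure (Or.inl (Or.inl ⟨T', T, T'', a, b, h, rfl⟩))
  have h0 : mk T - mk T' - mk T'' = 0 := (QuotientAddGroup.eq_zero_iff _).mpr hmem
  rwa [sub_sub, sub_eq_zero] at h0

/-- **Diagonal objects vanish**: `[ΔC] = 0` for `C ∈ C[F]`. [cite: Grayson2013RelativeKTheory, Definition 5 ff.] -/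
theorem mk_diag (c : GraysonTriple.CTriple f) : mk c.diag = 0 :=
  (QuotientAddGroup.eq_zero_iff _).mpr (AddSubgroup.subset_closure (Or.inl (Or.inr ⟨c, rfl⟩)))

/-- **Weak equivalences identify classes**: `[T] = [T']` for `T → T'` in `p`.
[cite: Grayson2013RelativeKTheory, Definition 5 ff.] -/
theorem mk_eq_mk_of_isWeakEquiv {T T' : GraysonTriple f} (h : GraysonTriple.Hom T T')
    (hh : h.IsWeakEquiv) : mk T = mk T' := by
  have hmem : FreeAbelianGroup.of T - FreeAbelianGroup.of T' ∈ relations f :=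
    AddSubgroup.subset_closure (Or.inr ⟨T, T', h, hh, rfl⟩)
  exact sub_eq_zero.mp ((QuotientAddGroup.eq_zero_iff _).mpr hmem)

/-- Induction on `K₀Ω[f^*]`: the classes of objects generate. [folklore] -/
theorem induction_on {P : RelKZero f → Prop} (x : RelKZero f) (zero : P 0)
    (of : ∀ T, P (mk T)) (neg : ∀ x, P x → P (-x)) (add : ∀ x y, P x → P y → P (x + y)) : P x := by
  obtain ⟨x, rfl⟩ := QuotientAddGroup.mk'_surjective (relations f) x
  induction x using FreeAbelianGroup.induction_on with
  | zero => rw [map_zero]; exact zero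
  | of T => exact of T
  | neg T _ => rw [map_neg]; exact neg _ (of T)
  | add x y hx hy => rw [map_add]; exact add _ _ hx hy

end RelKZero

/-! ## §4. The map `K₀Ω[f^*] → K₀(X)` -/

namespace GraysonTriple

variable {f}

/-- The image `χ(M₁) − χ(M₂) ∈ K₀(X)` of an object `(M, N, u)` (Euler characteristics,
`KTheory/EulerCharacteristic`; the composite `K₀Ω[F] → K₀Ω[𝓜 → 0] ≅ K₀𝓜` of Theorem 7 and Lemma 8 on
generators: "The class … of the object `((M, M'), N, (u, u'))` projects to `[M] − [M']` in `K₀𝓜`").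
[cite: Grayson2013RelativeKTheory, Theorem 7, Lemma 8, Lemma 19 (proof)] -/
def chi (T : GraysonTriple f) : KZero X :=
  eulerChar T.M₁ T.hM₁.isFiniteLocallyFree - eulerChar T.M₂ T.hM₂.isFiniteLocallyFree

/-- `χ` is additive on short exact sequences of `B[F]`. [cite: Grayson2013RelativeKTheory, Theorem 7] -/
theorem chi_eq_add_of_isShortExact {T' T T'' : GraysonTriple f} (a : Hom T' T) (b : Hom T T'')
    (h : IsShortExact a b) : T.chi = T'.chi + T''.chi := by
  obtain ⟨h₁, h₂, -⟩ := h
  have w₁ : a.φ₁ ≫ b.φ₁ = 0 := HomologicalComplex.hom_ext _ _ fun i ↦ by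
    rw [HomologicalComplex.comp_f, HomologicalComplex.zero_f]; exact (h₁ i).1
  have w₂ : a.φ₂ ≫ b.φ₂ = 0 := HomologicalComplex.hom_ext _ _ fun i ↦ by
    rw [HomologicalComplex.comp_f, HomologicalComplex.zero_f]; exact (h₂ i).1
  have e₁ := eulerChar_eq_add_of_shortExact (S := ShortComplex.mk a.φ₁ b.φ₁ w₁) T'.hM₁ T.hM₁ T''.hM₁
    (fun i ↦ (h₁ i).2)
  have e₂ := eulerChar_eq_add_of_shortExact (S := ShortComplex.mk a.φ₂ b.φ₂ w₂) T'.hM₂ T.hM₂ T''.hM₂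
    (fun i ↦ (h₂ i).2)
  change eulerChar T.M₁ _ - eulerChar T.M₂ _ =
    (eulerChar T'.M₁ _ - eulerChar T'.M₂ _) + (eulerChar T''.M₁ _ - eulerChar T''.M₂ _)
  change eulerChar T.M₁ _ = eulerChar T'.M₁ _ + eulerChar T''.M₁ _ at e₁
  change eulerChar T.M₂ _ = eulerChar T'.M₂ _ + eulerChar T''.M₂ _ at e₂
  rw [e₁, e₂]
  abel

/-- `χ(ΔC) = χ(M) − χ(M) = 0`. [cite: Grayson2013RelativeKTheory, Theorem 7] -/
theorem chi_diag (c : CTriple f) : c.diag.chi = 0 := sub_self _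

/-- `χ` is invariant under the weak equivalences `p`: quasi-isomorphic bounded complexes of vector
bundles have the same Euler characteristic (`IsBoundedVBComplex.eulerChar_eq_of_quasiIso`).
[cite: Grayson2013RelativeKTheory, Theorem 7] -/
theorem chi_eq_of_isWeakEquiv {T T' : GraysonTriple f} (h : Hom T T') (hh : h.IsWeakEquiv) :
    T.chi = T'.chi := by
  obtain ⟨hq₁, hq₂, -⟩ := hh
  change eulerChar T.M₁ _ - eulerChar T.M₂ _ = eulerChar T'.M₁ _ - eulerChar T'.M₂ _
  rw [T.hM₁.eulerChar_eq_of_quasiIso T'.hM₁ h.φ₁, T.hM₂.eulerChar_eq_of_quasiIso T'.hM₂ h.φ₂]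

/-- **`f^*(χ(M₁) − χ(M₂)) = 0`** for an object of `B[F]`: `f^*χ(Mᵢ) = χ(f^*Mᵢ)`, the comparison maps
`uᵢ` are quasi-isomorphisms, and `⊤N`, `⊥N` have the same terms, so `χ(f^*M₁) = χ(⊤N) = χ(⊥N) = χ(f^*M₂)`
(the `K₀𝓜`-part of Corollary 16: the sequence is a complex). [cite: Grayson2013RelativeKTheory, Corollary 16] -/
theorem map_chi (T : GraysonTriple f) : KZero.map f T.chi = 0 := by
  have := T.quasiIso₁
  have := T.quasiIso₂
  change KZero.map f (eulerChar T.M₁ _ - eulerChar T.M₂ _) = 0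
  rw [map_sub, map_eulerChar f T.hM₁, map_eulerChar f T.hM₂,
    (T.hM₁.pullback f).eulerChar_eq_of_quasiIso T.hN T.u₁,
    (T.hM₂.pullback f).eulerChar_eq_of_quasiIso T.hN_bot T.u₂, sub_eq_zero]
  exact eulerChar_eq_of_iso _ _ fun _ ↦ Iso.refl _

end GraysonTriple

namespace RelKZero

variable {f}

/-- **The homomorphism `K₀Ω[f^*] → K₀(X)`, `[(M, N, u)] ↦ χ(M₁) − χ(M₂)`** (the map of Theorem 7 into
`K₀Ω[𝓜 → 0] ≅ K₀𝓜`), well defined on Grayson's presentation: `χ` is additive on short exact sequences,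
kills diagonal objects and is invariant under `p`. [cite: Grayson2013RelativeKTheory, Theorem 7, Lemma 8] -/
def toKZero : RelKZero f →+ KZero X :=
  QuotientAddGroup.lift (relations f) (FreeAbelianGroup.lift GraysonTriple.chi)
    ((AddSubgroup.closure_le _).mpr (by
      rintro x ((⟨T', T, T'', a, b, h, rfl⟩ | ⟨c, rfl⟩) | ⟨T, T', h, hh, rfl⟩)
      · simp only [SetLike.mem_coe, AddMonoidHom.mem_ker, map_sub, FreeAbelianGroup.lift_apply_of,
          GraysonTriple.chi_eq_add_of_isShortExact a b h]
        abel
      · simp only [SetLike.mem_coe, AddMonoidHom.mem_ker, FreeAbelianGroup.lift_apply_of,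
          GraysonTriple.chi_diag]
      · simp only [SetLike.mem_coe, AddMonoidHom.mem_ker, map_sub, FreeAbelianGroup.lift_apply_of,
          GraysonTriple.chi_eq_of_isWeakEquiv h hh, sub_self]))

/-- The homomorphism on a class. [cite: Grayson2013RelativeKTheory, Theorem 7] -/
@[simp]
theorem toKZero_mk (T : GraysonTriple f) : toKZero (mk T) = T.chi :=
  (QuotientAddGroup.lift_mk' _ _ _).trans (FreeAbelianGroup.lift_apply_of _ _)

/-! ## §5. Exactness of `K₀Ω[f^*] → K₀(X) → K₀(Y)` -/

/-- **The composite `K₀Ω[f^*] → K₀(X) → K₀(Y)` is zero** (Corollary 16 at `K₀𝓜`).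
[cite: Grayson2013RelativeKTheory, Corollary 16] -/
theorem map_toKZero (x : RelKZero f) : KZero.map f (toKZero x) = 0 := by
  induction x using RelKZero.induction_on with
  | zero => rw [map_zero, map_zero]
  | of T => rw [toKZero_mk, T.map_chi]
  | neg x hx => rw [map_neg, map_neg, hx, neg_zero]
  | add x y hx hy => rw [map_add, map_add, hx, hy, add_zero]

/-- The image of `K₀Ω[f^*] → K₀(X)` lies in the kernel of `f^*`. [cite: Grayson2013RelativeKTheory, Corollary 16] -/
theorem range_toKZero_le_ker : (toKZero (f := f)).range ≤ (KZero.map f).ker := by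
  rintro _ ⟨x, rfl⟩
  exact map_toKZero x

end RelKZero

/-! ### Lemma 19: kernel classes are in the image -/

namespace BinaryComplex

variable {C : Type*} [Category C] [Abelian C] {A V₀ V₁ V₂ : C}

/-- The three-term complex `V₀ → V₁ → V₂` as the top complex of a three-term binary complex is exact in
degree `1` iff `V₀ → V₁ → V₂` is exact. [folklore] -/
theorem threeTerm_exactAt_one {b : V₀ ⟶ V₁} {c : V₁ ⟶ V₂} {w : b ≫ c = 0} {b' : V₀ ⟶ V₁}
    {c' : V₁ ⟶ V₂} {w' : b' ≫ c' = 0} (hbc : (ShortComplex.mk b c w).Exact) :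
    (threeTermBinary b c w b' c' w').top.ExactAt 1 :=
  ((threeTermBinary b c w b' c' w').top.exactAt_iff' 0 1 2 (by simp) (by simp)).2 hbc

/-- … exact in degree `2` iff `V₁ → V₂` is an epimorphism. [folklore] -/
theorem threeTerm_exactAt_two {b : V₀ ⟶ V₁} {c : V₁ ⟶ V₂} {w : b ≫ c = 0} {b' : V₀ ⟶ V₁}
    {c' : V₁ ⟶ V₂} {w' : b' ≫ c' = 0} (hc : Epi c) :
    (threeTermBinary b c w b' c' w').top.ExactAt 2 :=
  ((threeTermBinary b c w b' c' w').top.exactAt_iff' 1 2 3 (by simp) (by simp)).2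
    ((ShortComplex.exact_iff_epi _ rfl).2 hc)

/-- … and exact off `{0, 1, 2}` (zero terms). [folklore] -/
theorem threeTerm_exactAt_of_ne {b : V₀ ⟶ V₁} {c : V₁ ⟶ V₂} {w : b ≫ c = 0} {b' : V₀ ⟶ V₁}
    {c' : V₁ ⟶ V₂} {w' : b' ≫ c' = 0} (i : ℤ) (h0 : i ≠ 0) (h1 : i ≠ 1) (h2 : i ≠ 2) :
    (threeTermBinary b c w b' c' w').top.ExactAt i :=
  (HomologicalComplex.exactAt_iff _ i).2
    (ShortComplex.exact_of_isZero_X₂ _ (isZero_threeX i h0 h1 h2))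

/-- The map `A[0] → (V₀ → V₁ → V₂)` induced by `a : A → V₀` with `a ≫ b = 0`. [folklore] -/
def fromSingle (a : A ⟶ V₀) (b : V₀ ⟶ V₁) (c : V₁ ⟶ V₂) (wab : a ≫ b = 0) (w : b ≫ c = 0)
    (b' : V₀ ⟶ V₁) (c' : V₁ ⟶ V₂) (w' : b' ≫ c' = 0) :
    (HomologicalComplex.single C (ComplexShape.up ℤ) 0).obj A ⟶
      (threeTermBinary b c w b' c' w').top :=
  HomologicalComplex.mkHomFromSingle (K := (threeTermBinary b c w b' c' w').top) (j := 0) a (by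
    intro k hk
    obtain rfl : k = 1 := by change (0 : ℤ) + 1 = k at hk; omega
    exact wab)

/-- **The quasi-isomorphism of Lemma 19**: for an exact sequence `0 → A →ᵃ V₀ →ᵇ V₁ →ᶜ V₂ → 0`, the
map `A[0] → (V₀ → V₁ → V₂)` is a quasi-isomorphism ("regard `u` … as quasi-isomorphisms
`u : FM → ⊤N`"). [cite: Grayson2013RelativeKTheory, Lemma 19 (proof)] -/
theorem quasiIso_fromSingle (a : A ⟶ V₀) (b : V₀ ⟶ V₁) (c : V₁ ⟶ V₂) (wab : a ≫ b = 0)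
    (w : b ≫ c = 0) (b' : V₀ ⟶ V₁) (c' : V₁ ⟶ V₂) (w' : b' ≫ c' = 0) (ha : Mono a) (hc : Epi c)
    (hab : (ShortComplex.mk a b wab).Exact) (hbc : (ShortComplex.mk b c w).Exact) :
    QuasiIso (fromSingle a b c wab w b' c' w') := by
  rw [quasiIso_iff]
  intro i
  by_cases hi0 : i = 0
  · subst hi0
    rw [quasiIsoAt_iff' _ (-1) 0 1 (by simp) (by simp)]
    -- the degree-`0` component is `A[0]⁰ ≅ A →ᵃ V₀` (as a map to `V₀`, the degree-`0` term)
    set u0 : ((HomologicalComplex.single C (ComplexShape.up ℤ) 0).obj A).X 0 ⟶ V₀ :=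
      (fromSingle a b c wab w b' c' w').f 0 with hu0
    have hu0' : u0 = (HomologicalComplex.singleObjXSelf (ComplexShape.up ℤ) 0 A).hom ≫ a :=
      hu0.trans (HomologicalComplex.mkHomFromSingle_f _ _)
    have h0 : u0 ≫ b = 0 := by rw [hu0', Category.assoc, wab, comp_zero]
    refine (ShortComplex.quasiIso_iff_of_zeros _ rfl rfl rfl).2 ⟨?_, ?_⟩
    · change (ShortComplex.mk u0 b h0).Exact
      exact (exact_iff_of_epi_iso_mono (S₁ := ShortComplex.mk u0 b h0)
        (S₂ := ShortComplex.mk a b wab)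
        (HomologicalComplex.singleObjXSelf (ComplexShape.up ℤ) 0 A).hom (Iso.refl _) (𝟙 _)
        (by change _ ≫ a = u0 ≫ 𝟙 V₀; rw [Category.comp_id, hu0']) (by simp)).2 hab
    · change Mono u0
      rw [hu0']
      exact mono_comp _ _
  by_cases hi1 : i = 1
  · subst hi1
    exact (quasiIsoAt_iff_exactAt _ 1
      (HomologicalComplex.exactAt_single_obj _ _ _ _ (by decide))).2 (threeTerm_exactAt_one hbc)
  by_cases hi2 : i = 2
  · subst hi2
    exact (quasiIsoAt_iff_exactAt _ 2
      (HomologicalComplex.exactAt_single_obj _ _ _ _ (by decide))).2 (threeTerm_exactAt_two hc)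
  exact (quasiIsoAt_iff_exactAt _ i (HomologicalComplex.exactAt_single_obj _ _ _ _ hi0)).2
    (threeTerm_exactAt_of_ne i hi0 hi1 hi2)

/-- The same map into the BOTTOM complex of the three-term binary complex with differentials
`(b, c)` on top and `(b', c')` at the bottom, for `a' : A → V₀` with `a' ≫ b' = 0` (definitionally the
map `fromSingle` into the top complex of the binary complex with the two differentials interchanged).
[folklore] -/
def fromSingleBot (a' : A ⟶ V₀) (b : V₀ ⟶ V₁) (c : V₁ ⟶ V₂) (w : b ≫ c = 0) (b' : V₀ ⟶ V₁)
    (c' : V₁ ⟶ V₂) (wab' : a' ≫ b' = 0) (w' : b' ≫ c' = 0) :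
    (HomologicalComplex.single C (ComplexShape.up ℤ) 0).obj A ⟶
      (threeTermBinary b c w b' c' w').bot :=
  fromSingle a' b' c' wab' w' b c w

/-- The quasi-isomorphism of Lemma 19 into the bottom complex: for `0 → A →ᵃ' V₀ →ᵇ' V₁ →ᶜ' V₂ → 0`
exact, `A[0] → ⊥(V₀ → V₁ → V₂; (b, c), (b', c'))` is a quasi-isomorphism ("`u' : FM' → ⊥N`").
[cite: Grayson2013RelativeKTheory, Lemma 19 (proof)] -/
theorem quasiIso_fromSingleBot (a' : A ⟶ V₀) (b : V₀ ⟶ V₁) (c : V₁ ⟶ V₂) (w : b ≫ c = 0)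
    (b' : V₀ ⟶ V₁) (c' : V₁ ⟶ V₂) (wab' : a' ≫ b' = 0) (w' : b' ≫ c' = 0) (ha' : Mono a')
    (hc' : Epi c') (hab' : (ShortComplex.mk a' b' wab').Exact) (hbc' : (ShortComplex.mk b' c' w').Exact) :
    QuasiIso (fromSingleBot a' b c w b' c' wab' w') :=
  quasiIso_fromSingle a' b' c' wab' w' b c w ha' hc' hab' hbc'

end BinaryComplex

namespace RelKZero

variable {f}

/-- The three-term binary complex on vector bundles is a bounded binary complex of vector bundles.
[folklore] -/
theorem isBoundedVBComplex_threeTerm {V₀ V₁ V₂ : Y.Modules} (h₀ : IsFiniteLocallyFree V₀)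
    (h₁ : IsFiniteLocallyFree V₁) (h₂ : IsFiniteLocallyFree V₂) (b : V₀ ⟶ V₁) (c : V₁ ⟶ V₂)
    (w : b ≫ c = 0) (b' : V₀ ⟶ V₁) (c' : V₁ ⟶ V₂) (w' : b' ≫ c' = 0) :
    IsBoundedVBComplex (BinaryComplex.threeTermBinary b c w b' c' w').top := by
  refine ⟨fun i ↦ ?_, ⟨{0, 1, 2}, fun i hi ↦ ?_⟩⟩
  · change IsFiniteLocallyFree (BinaryComplex.threeX V₀ V₁ V₂ i)
    unfold BinaryComplex.threeX
    split
    · exact h₀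
    · exact h₁
    · exact h₂
    · exact KZero.isFiniteLocallyFree_of_isZero (isZero_zero _)
  · simp only [Finset.mem_insert, Finset.mem_singleton, not_or] at hi
    exact BinaryComplex.isZero_threeX i hi.1 hi.2.1 hi.2.2

/-- `f^*(M[0]) ≅ (f^*M)[0]`. [folklore] -/
def pullbackSingleIso (M : X.Modules) :
    (pullbackComplex f).obj ((HomologicalComplex.single X.Modules (ComplexShape.up ℤ) 0).obj M) ≅
      (HomologicalComplex.single Y.Modules (ComplexShape.up ℤ) 0).obj
        ((Scheme.Modules.pullback f).obj M) :=
  (HomologicalComplex.singleMapHomologicalComplex (Scheme.Modules.pullback f) (ComplexShape.up ℤ) 0).app M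

/-- **The object of Lemma 19.** Given vector bundles `M, M'` on `X` and exact sequences
`0 → f^*M →ᵃ V₀ →ᵇ V₁ →ᶜ V₂ → 0`, `0 → f^*M' →ᵃ' V₀ →ᵇ' V₁ →ᶜ' V₂ → 0` of vector bundles on `Y`, the object
`((M[0], M'[0]), (V₀ → V₁ → V₂; (b, c), (b', c')), (u, u'))` of `B[f^*]`.
[cite: Grayson2013RelativeKTheory, Lemma 19 (proof)] -/
def lemma19Triple {M M' : X.Modules} (hM : IsFiniteLocallyFree M) (hM' : IsFiniteLocallyFree M')
    {V₀ V₁ V₂ : Y.Modules} (h₀ : IsFiniteLocallyFree V₀) (h₁ : IsFiniteLocallyFree V₁)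
    (h₂ : IsFiniteLocallyFree V₂)
    (a : (Scheme.Modules.pullback f).obj M ⟶ V₀) (b : V₀ ⟶ V₁) (c : V₁ ⟶ V₂) (wab : a ≫ b = 0)
    (wbc : b ≫ c = 0) (ha : Mono a) (hc : Epi c) (hab : (ShortComplex.mk a b wab).Exact)
    (hbc : (ShortComplex.mk b c wbc).Exact)
    (a' : (Scheme.Modules.pullback f).obj M' ⟶ V₀) (b' : V₀ ⟶ V₁) (c' : V₁ ⟶ V₂)
    (wab' : a' ≫ b' = 0) (wbc' : b' ≫ c' = 0) (ha' : Mono a') (hc' : Epi c')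
    (hab' : (ShortComplex.mk a' b' wab').Exact) (hbc' : (ShortComplex.mk b' c' wbc').Exact) :
    GraysonTriple f where
  M₁ := (HomologicalComplex.single X.Modules (ComplexShape.up ℤ) 0).obj M
  M₂ := (HomologicalComplex.single X.Modules (ComplexShape.up ℤ) 0).obj M'
  N := BinaryComplex.threeTermBinary b c wbc b' c' wbc'
  u₁ := (pullbackSingleIso M).hom ≫ BinaryComplex.fromSingle a b c wab wbc b' c' wbc'
  u₂ := (pullbackSingleIso M').hom ≫ BinaryComplex.fromSingleBot a' b c wbc b' c' wab' wbc'
  hM₁ := IsBoundedVBComplex.single M hM 0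
  hM₂ := IsBoundedVBComplex.single M' hM' 0
  hN := isBoundedVBComplex_threeTerm h₀ h₁ h₂ b c wbc b' c' wbc'
  quasiIso₁ := by
    have := BinaryComplex.quasiIso_fromSingle a b c wab wbc b' c' wbc' ha hc hab hbc
    infer_instance
  quasiIso₂ := by
    have := BinaryComplex.quasiIso_fromSingleBot a' b c wbc b' c' wab' wbc' ha' hc' hab' hbc'
    infer_instance

/-- The object of Lemma 19 "projects to `[M] − [M']` in `K₀𝓜`". [cite: Grayson2013RelativeKTheory, Lemma 19 (proof)] -/
theorem chi_lemma19Triple {M M' : X.Modules} (hM : IsFiniteLocallyFree M)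
    (hM' : IsFiniteLocallyFree M') {V₀ V₁ V₂ : Y.Modules} (h₀ : IsFiniteLocallyFree V₀)
    (h₁ : IsFiniteLocallyFree V₁) (h₂ : IsFiniteLocallyFree V₂)
    (a : (Scheme.Modules.pullback f).obj M ⟶ V₀) (b : V₀ ⟶ V₁) (c : V₁ ⟶ V₂) (wab : a ≫ b = 0)
    (wbc : b ≫ c = 0) (ha : Mono a) (hc : Epi c) (hab : (ShortComplex.mk a b wab).Exact)
    (hbc : (ShortComplex.mk b c wbc).Exact)
    (a' : (Scheme.Modules.pullback f).obj M' ⟶ V₀) (b' : V₀ ⟶ V₁) (c' : V₁ ⟶ V₂)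
    (wab' : a' ≫ b' = 0) (wbc' : b' ≫ c' = 0) (ha' : Mono a') (hc' : Epi c')
    (hab' : (ShortComplex.mk a' b' wab').Exact) (hbc' : (ShortComplex.mk b' c' wbc').Exact) :
    (lemma19Triple hM hM' h₀ h₁ h₂ a b c wab wbc ha hc hab hbc a' b' c' wab' wbc' ha' hc' hab'
      hbc').chi = KZero.of M hM - KZero.of M' hM' := by
  change eulerChar ((HomologicalComplex.single X.Modules (ComplexShape.up ℤ) 0).obj M) _ -
    eulerChar ((HomologicalComplex.single X.Modules (ComplexShape.up ℤ) 0).obj M') _ = _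
  rw [eulerChar_single M hM 0, eulerChar_single M' hM' 0, Int.negOnePow_zero, Units.val_one,
    one_smul, one_smul]

/-- **Grayson's Lemma 19** (exactness of `K₀Ω[F] → K₀𝓜 → K₀𝓝` at `K₀𝓜`, the non-trivial inclusion):
every class of `K₀(X)` killed by `f^*` is in the image of `K₀Ω[f^*] → K₀(X)`. Proof as printed: write
the class as `[M] − [M']` (`KZero.exists_eq_of_sub_of`); `[f^*M] = [f^*M']` gives, by Corollary 18
(`KZero.of_eq_of_iff_exists_fourTermExact`), vector bundles `V₀, V₁, V₂` and exact
`0 → f^*M → V₀ → V₁ → V₂ → 0`, `0 → f^*M' → V₀ → V₁ → V₂ → 0`; the object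
`((M[0], M'[0]), (V₀ → V₁ → V₂; d, d'), (u, u'))` of `B[f^*]` maps to `[M] − [M']`.
[cite: Grayson2013RelativeKTheory, Lemma 19] -/
theorem ker_le_range_toKZero : (KZero.map f).ker ≤ (toKZero (f := f)).range := by
  intro x hx
  obtain ⟨M, M', hM, hM', rfl⟩ := KZero.exists_eq_of_sub_of x
  rw [AddMonoidHom.mem_ker, map_sub, sub_eq_zero, KZero.map_of, KZero.map_of,
    KZero.of_eq_of_iff_exists_fourTermExact] at hx
  obtain ⟨V₀, V₁, V₂, h₀, h₁, h₂, ⟨a, b, c, wab, wbc, ha, hc, hab, hbc⟩,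
    ⟨a', b', c', wab', wbc', ha', hc', hab', hbc'⟩⟩ := hx
  exact ⟨mk (lemma19Triple hM hM' h₀ h₁ h₂ a b c wab wbc ha hc hab hbc a' b' c' wab' wbc' ha' hc'
    hab' hbc'), by rw [toKZero_mk, chi_lemma19Triple]⟩

/-- **Grayson's Theorem 7 / Corollary 9 at `K₀𝓜`, for `F = f^*`**: the image of
`K₀Ω[f^*] → K₀(X)` is exactly the kernel of `f^* : K₀(X) → K₀(Y)` — the sequence
`K₀Ω[f^*] → K₀(X) → K₀(Y)` is exact ("Given an exact functor `F : 𝓜 → 𝓝` between exact categories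
… the sequence `K₁𝓜 → K₁𝓝 → K₀Ω[F] → K₀𝓜 → K₀𝓝` is exact"; here its last exactness, for the pull-back
of vector bundles along a morphism of schemes). [cite: Grayson2013RelativeKTheory, Theorem 7, Corollary 9] -/
theorem range_toKZero_eq_ker : (toKZero (f := f)).range = (KZero.map f).ker :=
  le_antisymm range_toKZero_le_ker ker_le_range_toKZero

/-- The same, element-wise: `f^* x = 0 ↔ x ∈ im(K₀Ω[f^*] → K₀(X))`. [cite: Grayson2013RelativeKTheory, Theorem 7] -/
theorem map_eq_zero_iff_exists (x : KZero X) :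
    KZero.map f x = 0 ↔ ∃ y : RelKZero f, toKZero y = x := by
  rw [← AddMonoidHom.mem_ker, ← range_toKZero_eq_ker]
  rfl

end RelKZero

end Literature.AlgebraicGeometry.KTheory

end
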